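import Summits.AtomisticToContinuum.HydrodynamicLimit.Theses.JParityClosure
import Summits.AtomisticToContinuum.HydrodynamicLimit.Theorems.JParityClosureOddContactSymmetryTubeStatRegular
import Literature.MathematicalPhysics.KineticTheory.HardSphereEulerProofs

/-!
# Negative knowledge for crux `JParityClosure.OddContactSymmetry` (stmt-AtomisticToContinuum-13078):
# the velocity-hole weight — the untruncated reweighting `1 + e^{−F}` is unbounded, configuration by configuration

Second line lead `prover-line-stmt-AtomisticToContinuum-13078-0` (2026-08-16), kernel-checked core of the tightness defect
found by lead `…-13078-r-0` (`Cruxes/OddContactSymmetry/BlowupAnalysis.md`) and independently estimated by the triage seats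
r1-2 / r1-3 (§0).  Everything here is a DETERMINISTIC statement about one configuration `w` of `N + 1` particles on `𝕋³`
and the crux's own mollified objects (the `let`-chain of the route declaration, verbatim):

* `bx x y = 3/(π r³) · max(1 − dist(x,y)/r, 0)` (cone kernel), `ρm(x₀) = ∫ bx(q.1, x₀) dμ_w`,
  `hm(x₀, u) = ∫ bx(q.1, x₀) · localMaxwellian 1 ϑ² u q.2 dμ_w` (`μ_w` = `empiricalMeasure w`), i.e.
  `hm(x₀, u) = (N+1)⁻¹ Σ_k bx(x_k, x₀) φ_ϑ(u − v_k)` (`integral_empiricalMeasure`);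
* the crux's surprisal jump at a contact of the ordered pair `(i, j)` is
  `F = log hm(xᵢ, v⁻) + log hm(xᵢ, w⁻) − log hm(xᵢ, vᵢ) − log hm(xᵢ, vⱼ)`, where — trajectories being RIGHT-continuous
  (`IsHardSphereTrajectory.binary`) — `vᵢ, vⱼ` are the CURRENT (post-collisional) velocities and
  `(v⁻, w⁻) = reflectVel (sepVec xᵢ xⱼ) (vᵢ, vⱼ)` the pre-collisional ones, which are velocities of NO particle of `w`.

Results (no dynamics, no probability):

* `hMoll_self_ge`, `hMoll_partner_ge` — the numerator of `e^{−F}` carries the two SELF-SPIKES: `hm(xᵢ, vᵢ) ≥ s₀` and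
  `hm(xᵢ, vⱼ) ≥ s₀ (1 − ε/r)` whenever `dist(xⱼ, xᵢ) ≤ ε ≤ r`, with `s₀ = (N+1)⁻¹ (3/πr³) (2πϑ²)^{−3/2}`.
* `hMoll_le_of_isolated` — the denominator does not: if `u` is at distance `≥ d` from EVERY current velocity then
  `hm(x₀, u) ≤ ρm(x₀) (2πϑ²)^{−3/2} e^{−d²/2ϑ²}`.
* `exp_neg_surprisal_ge_rhoMoll`, `exp_neg_surprisal_ge` — hence, for any two query velocities `v⁻, w⁻` isolated by
  `d₁, d₂ ≥ 0` from the current velocity cloud,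
  `e^{−F} ≥ (3/πr³)² (1 − ε/r) / ((N+1)² ρm(xᵢ)²) · e^{(d₁²+d₂²)/2ϑ²} ≥ (1 − ε/r) (N+1)^{−2} e^{(d₁²+d₂²)/2ϑ²}`.
  So ONE ordered contact pair contributes at least `σ (N+1)^{−10/3} (1 − ε/r) |χ g Ψ| e^{(d₁²+d₂²)/2ϑ²}` to the crux statistic
  `D = K_N[χ g Ψ (1+e^{−F})]` (weight `ε/(N+1) = σ(N+1)^{−4/3}` per ordered pair): the weight is unbounded over configurations at
  every fixed `(N, r, ϑ)`, exponentially in the squared velocity isolation at scale `ϑ`, and it beats the normalisation as soon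
  as `d₁² > (20/3) ϑ² ln(N+1)`.  At global equilibrium the fastest incoming particle of `[0, τ]` (speed² ≈ (8/3)θ ln N, out of
  `≍ N^{4/3}` collisions) is isolated from its instantaneous cloud (edge² ≈ 2θ ln N) by `d₁ ≈ 0.219 √(θ ln N)`, which exceeds
  `√(20/3) ϑ √(ln N)` iff `ϑ < 0.0848 √θ` — whereas the crux lets the adversary choose `ϑ ∈ (0, r₀)` after `r₀`
  (BlowupAnalysis.md §2–§4 for the sharper threshold `0.12–0.13√θ` and the no-cancellation argument; that probabilistic /
  dynamical step is NOT formalised here and cannot be without `HardSphereFlow.nonempty_torus`, cf.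
  `not_oddContactSymmetry_requires_flows`).
* `shell_support_confines_queries` — why the planner's repair C′ (marks `Ψ` supported in an energy shell
  `‖v‖² + ‖w‖² < R`) removes the mechanism: by energy conservation of `reflectVel` all FOUR `hm`-queries of a contributing
  collision then lie in the closed ball of radius `√R`, where the bound of `hMoll_le_of_isolated` is harmless.
-/

noncomputable section

open scoped InnerProductSpace BigOperators
open MeasureTheory

namespace Summit.AtomisticToContinuum.HydrodynamicLimit.Theorems

namespace OddContactSymmetryNegative

open Literature.Analysis.FluidPDE Literature.MathematicalPhysics.KineticTheory

variable {N : ℕ}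

/-! ## The cone kernel and the Gaussian velocity kernel -/

/-- The cone kernel at coincident points takes its maximal value `3/(π r³)`. [folklore] -/
theorem coneKernel_self (r : ℝ) (x : T3) :
    3 / (Real.pi * r ^ 3) * max (1 - Torus.euclidDist x x / r) 0 = 3 / (Real.pi * r ^ 3) := by
  rw [Torus.euclidDist_self, zero_div, sub_zero, max_eq_left zero_le_one, mul_one]

/-- The cone kernel at distance `≤ ε` is at least `3/(π r³) · (1 − ε/r)` (`r > 0`). [folklore] -/
theorem coneKernel_ge_of_dist_le {r ε : ℝ} (hr : 0 < r) {x y : T3} (h : Torus.euclidDist x y ≤ ε) :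
    3 / (Real.pi * r ^ 3) * (1 - ε / r) ≤ 3 / (Real.pi * r ^ 3) * max (1 - Torus.euclidDist x y / r) 0 := by
  refine mul_le_mul_of_nonneg_left (le_trans ?_ (le_max_left _ _)) (by positivity)
  exact sub_le_sub_left (div_le_div_of_nonneg_right h hr.le) 1

/-- The unit-mass Gaussian velocity kernel at its own centre: `φ_θ(0) = (2πθ)^{−d/2}`. [folklore] -/
theorem localMaxwellian_one_apply_self (θ : ℝ) (v : V3) :
    localMaxwellian 1 θ v v = (2 * Real.pi * θ) ^ (-(Module.finrank ℝ V3 : ℝ) / 2) := by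
  simp only [localMaxwellian, sub_self, norm_zero, one_mul]
  simp

/-- Off-centre decay of the Gaussian velocity kernel: if `d ≤ ‖u − v‖` with `d ≥ 0` and `θ > 0` then
`φ_θ(u − v) ≤ (2πθ)^{−d/2} e^{−d²/2θ}`. [folklore] -/
theorem localMaxwellian_one_le_of_le_norm_sub {θ d : ℝ} (hθ : 0 < θ) (hd : 0 ≤ d) {v u : V3}
    (h : d ≤ ‖u - v‖) :
    localMaxwellian 1 θ v u ≤
      (2 * Real.pi * θ) ^ (-(Module.finrank ℝ V3 : ℝ) / 2) * Real.exp (-d ^ 2 / (2 * θ)) := by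
  simp only [localMaxwellian, one_mul]
  refine mul_le_mul_of_nonneg_left ?_ (Real.rpow_nonneg (by positivity) _)
  refine Real.exp_le_exp.2 ?_
  have hsq : d ^ 2 ≤ ‖u - v‖ ^ 2 := pow_le_pow_left₀ hd h 2
  have h2θ : 0 < 2 * θ := by positivity
  rw [neg_div, neg_div, neg_le_neg_iff]
  exact div_le_div_of_nonneg_right hsq h2θ.le

/-! ## The mollified empirical objects of one configuration: closed forms and elementary bounds -/

/-- Closed form of the cone-mollified empirical density `ρm(x₀) = (N+1)⁻¹ Σ_k bx(x_k, x₀)`. [folklore] -/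
theorem rhoMoll_eq_sum (w : Config (N + 1) (Fin 3) T3) (r : ℝ) (x₀ : T3) :
    ∫ q, 3 / (Real.pi * r ^ 3) * max (1 - Torus.euclidDist q.1 x₀ / r) 0 ∂(empiricalMeasure w) =
      ((N : ℝ) + 1)⁻¹ * ∑ k, 3 / (Real.pi * r ^ 3) * max (1 - Torus.euclidDist (w k).1 x₀ / r) 0 := by
  rw [integral_empiricalMeasure]
  push_cast
  ring

/-- Closed form of the `(r, ϑ)`-mollified empirical one-particle law
`hm(x₀, u) = (N+1)⁻¹ Σ_k bx(x_k, x₀) φ_ϑ(u − v_k)`. [folklore] -/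
theorem hMoll_eq_sum (w : Config (N + 1) (Fin 3) T3) (r ϑ : ℝ) (x₀ : T3) (u : V3) :
    ∫ q, 3 / (Real.pi * r ^ 3) * max (1 - Torus.euclidDist q.1 x₀ / r) 0 *
        localMaxwellian 1 (ϑ ^ 2) u q.2 ∂(empiricalMeasure w) =
      ((N : ℝ) + 1)⁻¹ * ∑ k, 3 / (Real.pi * r ^ 3) * max (1 - Torus.euclidDist (w k).1 x₀ / r) 0 *
        localMaxwellian 1 (ϑ ^ 2) u (w k).2 := by
  rw [integral_empiricalMeasure]
  push_cast
  ring

/-- The cone-mollified empirical density lies in `[0, 3/(π r³)]` (`r > 0`). [folklore] -/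
theorem rhoMoll_nonneg_le (w : Config (N + 1) (Fin 3) T3) {r : ℝ} (hr : 0 < r) (x₀ : T3) :
    0 ≤ ∫ q, 3 / (Real.pi * r ^ 3) * max (1 - Torus.euclidDist q.1 x₀ / r) 0 ∂(empiricalMeasure w) ∧
      ∫ q, 3 / (Real.pi * r ^ 3) * max (1 - Torus.euclidDist q.1 x₀ / r) 0 ∂(empiricalMeasure w) ≤
        3 / (Real.pi * r ^ 3) := by
  rw [rhoMoll_eq_sum]
  have hn : (0 : ℝ) < (N : ℝ) + 1 := by positivity
  have hsum0 : 0 ≤ ∑ k, 3 / (Real.pi * r ^ 3) * max (1 - Torus.euclidDist (w k).1 x₀ / r) 0 :=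
    Finset.sum_nonneg fun k _ => (coneKernel_nonneg_le hr (w k).1 x₀).1
  refine ⟨mul_nonneg (inv_nonneg.2 hn.le) hsum0, ?_⟩
  rw [inv_mul_le_iff₀ hn]
  calc ∑ k, 3 / (Real.pi * r ^ 3) * max (1 - Torus.euclidDist (w k).1 x₀ / r) 0
      ≤ ∑ _k : Fin (N + 1), 3 / (Real.pi * r ^ 3) :=
        Finset.sum_le_sum fun k _ => (coneKernel_nonneg_le hr (w k).1 x₀).2
    _ = ((N : ℝ) + 1) * (3 / (Real.pi * r ^ 3)) := by
        rw [Finset.sum_const, Finset.card_univ, Fintype.card_fin, nsmul_eq_mul]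
        push_cast
        ring

/-- At a particle's own position the cone-mollified density is at least the self term
`(N+1)⁻¹ · 3/(π r³) > 0`. [folklore] -/
theorem rhoMoll_self_ge (w : Config (N + 1) (Fin 3) T3) {r : ℝ} (hr : 0 < r) (i : Fin (N + 1)) :
    ((N : ℝ) + 1)⁻¹ * (3 / (Real.pi * r ^ 3)) ≤
      ∫ q, 3 / (Real.pi * r ^ 3) * max (1 - Torus.euclidDist q.1 (w i).1 / r) 0 ∂(empiricalMeasure w) := by
  rw [rhoMoll_eq_sum]
  refine mul_le_mul_of_nonneg_left ?_ (by positivity)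
  have h := Finset.single_le_sum
    (f := fun k => 3 / (Real.pi * r ^ 3) * max (1 - Torus.euclidDist (w k).1 (w i).1 / r) 0)
    (fun k _ => (coneKernel_nonneg_le hr (w k).1 (w i).1).1) (Finset.mem_univ i)
  rwa [coneKernel_self] at h

/-- **No velocity hole in the numerator (self-spike).**  At particle `i`'s own position and own velocity the mollified
law is at least `s₀ = (N+1)⁻¹ · 3/(π r³) · (2πϑ²)^{−3/2}`. [folklore] -/
theorem hMoll_self_ge (w : Config (N + 1) (Fin 3) T3) {r ϑ : ℝ} (hr : 0 < r) (hϑ : 0 < ϑ) (i : Fin (N + 1)) :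
    ((N : ℝ) + 1)⁻¹ * (3 / (Real.pi * r ^ 3) * (2 * Real.pi * ϑ ^ 2) ^ (-(Module.finrank ℝ V3 : ℝ) / 2)) ≤
      ∫ q, 3 / (Real.pi * r ^ 3) * max (1 - Torus.euclidDist q.1 (w i).1 / r) 0 *
        localMaxwellian 1 (ϑ ^ 2) (w i).2 q.2 ∂(empiricalMeasure w) := by
  rw [hMoll_eq_sum]
  refine mul_le_mul_of_nonneg_left ?_ (by positivity)
  have hϑ2 : 0 < ϑ ^ 2 := by positivity
  have hterm : 3 / (Real.pi * r ^ 3) * (2 * Real.pi * ϑ ^ 2) ^ (-(Module.finrank ℝ V3 : ℝ) / 2) =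
      3 / (Real.pi * r ^ 3) * max (1 - Torus.euclidDist (w i).1 (w i).1 / r) 0 *
        localMaxwellian 1 (ϑ ^ 2) (w i).2 (w i).2 := by
    simp only [coneKernel_self, localMaxwellian_one_apply_self]
  rw [hterm]
  exact Finset.single_le_sum
    (f := fun k => 3 / (Real.pi * r ^ 3) * max (1 - Torus.euclidDist (w k).1 (w i).1 / r) 0 *
      localMaxwellian 1 (ϑ ^ 2) (w i).2 (w k).2)
    (fun k _ => mul_nonneg (coneKernel_nonneg_le hr (w k).1 (w i).1).1
      (localMaxwellian_nonneg zero_le_one hϑ2.le _ _)) (Finset.mem_univ i)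

/-- **No velocity hole in the numerator (partner spike).**  At particle `i`'s position and the CURRENT velocity of a
particle `j` within distance `ε ≤ r` (at contact: `dist = ε`), the mollified law is at least `s₀ (1 − ε/r)`. [folklore] -/
theorem hMoll_partner_ge (w : Config (N + 1) (Fin 3) T3) {r ϑ ε : ℝ} (hr : 0 < r) (hϑ : 0 < ϑ)
    {i j : Fin (N + 1)} (hdist : Torus.euclidDist (w j).1 (w i).1 ≤ ε) :
    ((N : ℝ) + 1)⁻¹ * (3 / (Real.pi * r ^ 3) * (1 - ε / r) * (2 * Real.pi * ϑ ^ 2) ^ (-(Module.finrank ℝ V3 : ℝ) / 2)) ≤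
      ∫ q, 3 / (Real.pi * r ^ 3) * max (1 - Torus.euclidDist q.1 (w i).1 / r) 0 *
        localMaxwellian 1 (ϑ ^ 2) (w j).2 q.2 ∂(empiricalMeasure w) := by
  rw [hMoll_eq_sum]
  refine mul_le_mul_of_nonneg_left ?_ (by positivity)
  have hϑ2 : 0 < ϑ ^ 2 := by positivity
  have hstep : 3 / (Real.pi * r ^ 3) * (1 - ε / r) * (2 * Real.pi * ϑ ^ 2) ^ (-(Module.finrank ℝ V3 : ℝ) / 2) ≤
      3 / (Real.pi * r ^ 3) * max (1 - Torus.euclidDist (w j).1 (w i).1 / r) 0 *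
        localMaxwellian 1 (ϑ ^ 2) (w j).2 (w j).2 := by
    rw [localMaxwellian_one_apply_self]
    exact mul_le_mul_of_nonneg_right (coneKernel_ge_of_dist_le hr hdist) (Real.rpow_nonneg (by positivity) _)
  refine le_trans hstep ?_
  exact Finset.single_le_sum
    (f := fun k => 3 / (Real.pi * r ^ 3) * max (1 - Torus.euclidDist (w k).1 (w i).1 / r) 0 *
      localMaxwellian 1 (ϑ ^ 2) (w j).2 (w k).2)
    (fun k _ => mul_nonneg (coneKernel_nonneg_le hr (w k).1 (w i).1).1
      (localMaxwellian_nonneg zero_le_one hϑ2.le _ _)) (Finset.mem_univ j)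

/-- At a particle's own position the mollified law is everywhere positive (so the crux's `F` is an honest real number:
no `log 0`). [folklore] -/
theorem hMoll_pos (w : Config (N + 1) (Fin 3) T3) {r ϑ : ℝ} (hr : 0 < r) (hϑ : 0 < ϑ) (i : Fin (N + 1)) (u : V3) :
    0 < ∫ q, 3 / (Real.pi * r ^ 3) * max (1 - Torus.euclidDist q.1 (w i).1 / r) 0 *
        localMaxwellian 1 (ϑ ^ 2) u q.2 ∂(empiricalMeasure w) := by
  rw [hMoll_eq_sum]
  have hϑ2 : 0 < ϑ ^ 2 := by positivity
  have hle := Finset.single_le_sum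
    (f := fun k => 3 / (Real.pi * r ^ 3) * max (1 - Torus.euclidDist (w k).1 (w i).1 / r) 0 *
      localMaxwellian 1 (ϑ ^ 2) u (w k).2)
    (fun k _ => mul_nonneg (coneKernel_nonneg_le hr (w k).1 (w i).1).1
      (localMaxwellian_nonneg zero_le_one hϑ2.le _ _)) (Finset.mem_univ i)
  have hpos : 0 < 3 / (Real.pi * r ^ 3) * max (1 - Torus.euclidDist (w i).1 (w i).1 / r) 0 *
      localMaxwellian 1 (ϑ ^ 2) u (w i).2 := by
    rw [coneKernel_self]
    exact mul_pos (by positivity) (localMaxwellian_pos one_pos hϑ2 _ _)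
  exact mul_pos (by positivity) (lt_of_lt_of_le hpos hle)

/-- **The velocity hole.**  If the query velocity `u` is at distance at least `d ≥ 0` from EVERY current velocity of the
configuration, then `hm(x₀, u) ≤ ρm(x₀) · (2πϑ²)^{−3/2} e^{−d²/2ϑ²}`: the mollified empirical law is exponentially small
in the squared isolation at scale `ϑ` (a kernel density estimate cannot see beyond its samples). [folklore] -/
theorem hMoll_le_of_isolated (w : Config (N + 1) (Fin 3) T3) {r ϑ d : ℝ} (hr : 0 < r) (hϑ : 0 < ϑ) (hd : 0 ≤ d)
    (x₀ : T3) {u : V3} (hiso : ∀ k, d ≤ ‖u - (w k).2‖) :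
    ∫ q, 3 / (Real.pi * r ^ 3) * max (1 - Torus.euclidDist q.1 x₀ / r) 0 *
        localMaxwellian 1 (ϑ ^ 2) u q.2 ∂(empiricalMeasure w) ≤
      (∫ q, 3 / (Real.pi * r ^ 3) * max (1 - Torus.euclidDist q.1 x₀ / r) 0 ∂(empiricalMeasure w)) *
        ((2 * Real.pi * ϑ ^ 2) ^ (-(Module.finrank ℝ V3 : ℝ) / 2) * Real.exp (-d ^ 2 / (2 * ϑ ^ 2))) := by
  rw [hMoll_eq_sum, rhoMoll_eq_sum, mul_assoc, Finset.sum_mul]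
  refine mul_le_mul_of_nonneg_left (Finset.sum_le_sum fun k _ => ?_) (by positivity)
  have hϑ2 : 0 < ϑ ^ 2 := by positivity
  refine mul_le_mul_of_nonneg_left ?_ (coneKernel_nonneg_le hr (w k).1 x₀).1
  -- `localMaxwellian 1 ϑ² u v_k = φ(v_k − u)`; isolation is symmetric in the difference
  have h' : d ≤ ‖(w k).2 - u‖ := by rw [norm_sub_rev]; exact hiso k
  exact localMaxwellian_one_le_of_le_norm_sub hϑ2 hd h'

/-! ## The weight of one velocity-hole collision -/

/-- **Lower bound on the crux's reweighting factor at one contact, with the local density.**  For a configuration `w`,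
an ordered pair `(i, j)` with `dist(xⱼ, xᵢ) ≤ ε ≤ r` (at a contact of the hard-sphere flow `‖sepVec xᵢ xⱼ‖ = ε`), and ANY two
query velocities `v⁻, w⁻` (in the crux: the pre-collisional velocities `reflectVel (sepVec xᵢ xⱼ) (vᵢ, vⱼ)`) isolated from
every current velocity by `d₁, d₂ ≥ 0`, the crux's factor `e^{−F} = hm(vᵢ)hm(vⱼ)/(hm(v⁻)hm(w⁻))` (all at `xᵢ`) satisfies
`e^{−F} ≥ (3/πr³)² (1 − ε/r) / ((N+1)² ρm(xᵢ)²) · exp((d₁² + d₂²)/2ϑ²)`. [folklore] -/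
theorem exp_neg_surprisal_ge_rhoMoll (w : Config (N + 1) (Fin 3) T3) {r ϑ ε d₁ d₂ : ℝ}
    (hr : 0 < r) (hϑ : 0 < ϑ) (hεr : ε ≤ r) (hd₁ : 0 ≤ d₁) (hd₂ : 0 ≤ d₂)
    {i j : Fin (N + 1)} (hdist : Torus.euclidDist (w j).1 (w i).1 ≤ ε) (vm wm : V3)
    (hvm : ∀ k, d₁ ≤ ‖vm - (w k).2‖) (hwm : ∀ k, d₂ ≤ ‖wm - (w k).2‖) :
    let ρm : ℝ := ∫ q, 3 / (Real.pi * r ^ 3) * max (1 - Torus.euclidDist q.1 (w i).1 / r) 0 ∂(empiricalMeasure w)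
    let hm : V3 → ℝ := fun u => ∫ q, 3 / (Real.pi * r ^ 3) * max (1 - Torus.euclidDist q.1 (w i).1 / r) 0 *
      localMaxwellian 1 (ϑ ^ 2) u q.2 ∂(empiricalMeasure w)
    (3 / (Real.pi * r ^ 3)) ^ 2 * (1 - ε / r) / (((N : ℝ) + 1) ^ 2 * ρm ^ 2) *
        Real.exp ((d₁ ^ 2 + d₂ ^ 2) / (2 * ϑ ^ 2)) ≤
      Real.exp (-(Real.log (hm vm) + Real.log (hm wm) - Real.log (hm (w i).2) - Real.log (hm (w j).2))) := by
  intro ρm hm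
  -- the four values of `hm` and the local density are positive
  have ha : 0 < hm vm := hMoll_pos w hr hϑ i vm
  have hb : 0 < hm wm := hMoll_pos w hr hϑ i wm
  have hc : 0 < hm (w i).2 := hMoll_pos w hr hϑ i (w i).2
  have hd : 0 < hm (w j).2 := hMoll_pos w hr hϑ i (w j).2
  have hρ : 0 < ρm := lt_of_lt_of_le (by positivity) (rhoMoll_self_ge w hr i)
  -- abbreviations for the constants
  set n : ℝ := (N : ℝ) + 1 with hn_def
  have hn : 0 < n := by positivity
  set b₀ : ℝ := 3 / (Real.pi * r ^ 3) with hb₀_def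
  have hb₀ : 0 < b₀ := by positivity
  set c : ℝ := (2 * Real.pi * ϑ ^ 2) ^ (-(Module.finrank ℝ V3 : ℝ) / 2) with hc_def
  have hcpos : 0 < c := Real.rpow_pos_of_pos (by positivity) _
  set e₁ : ℝ := Real.exp (-d₁ ^ 2 / (2 * ϑ ^ 2)) with he₁_def
  set e₂ : ℝ := Real.exp (-d₂ ^ 2 / (2 * ϑ ^ 2)) with he₂_def
  set E : ℝ := Real.exp ((d₁ ^ 2 + d₂ ^ 2) / (2 * ϑ ^ 2)) with hE_def
  have hεr' : 0 ≤ 1 - ε / r := by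
    rw [sub_nonneg, div_le_one hr]
    exact hεr
  -- the four one-sided bounds
  have h1 : n⁻¹ * (b₀ * c) ≤ hm (w i).2 := hMoll_self_ge w hr hϑ i
  have h2 : n⁻¹ * (b₀ * (1 - ε / r) * c) ≤ hm (w j).2 := hMoll_partner_ge w hr hϑ hdist
  have h3 : hm vm ≤ ρm * (c * e₁) := hMoll_le_of_isolated w hr hϑ hd₁ (w i).1 hvm
  have h4 : hm wm ≤ ρm * (c * e₂) := hMoll_le_of_isolated w hr hϑ hd₂ (w i).1 hwm
  have hEe : E * (e₁ * e₂) = 1 := by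
    rw [hE_def, he₁_def, he₂_def, ← Real.exp_add, ← Real.exp_add]
    convert Real.exp_zero using 2
    ring
  -- `e^{−F} = hm(vᵢ) hm(vⱼ) / (hm(v⁻) hm(w⁻))`
  have hexp : Real.exp (-(Real.log (hm vm) + Real.log (hm wm) - Real.log (hm (w i).2) - Real.log (hm (w j).2))) =
      hm (w i).2 * hm (w j).2 / (hm vm * hm wm) := by
    rw [show -(Real.log (hm vm) + Real.log (hm wm) - Real.log (hm (w i).2) - Real.log (hm (w j).2)) =
        (Real.log (hm (w i).2) + Real.log (hm (w j).2)) - (Real.log (hm vm) + Real.log (hm wm)) by ring,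
      Real.exp_sub, Real.exp_add, Real.exp_add, Real.exp_log ha, Real.exp_log hb, Real.exp_log hc,
      Real.exp_log hd]
  rw [hexp, le_div_iff₀ (mul_pos ha hb)]
  calc b₀ ^ 2 * (1 - ε / r) / (n ^ 2 * ρm ^ 2) * E * (hm vm * hm wm)
      ≤ b₀ ^ 2 * (1 - ε / r) / (n ^ 2 * ρm ^ 2) * E * ((ρm * (c * e₁)) * (ρm * (c * e₂))) := by
        gcongr
    _ = b₀ ^ 2 * (1 - ε / r) / (n ^ 2 * ρm ^ 2) * (ρm * c) ^ 2 * (E * (e₁ * e₂)) := by ring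
    _ = (n⁻¹ * (b₀ * c)) * (n⁻¹ * (b₀ * (1 - ε / r) * c)) := by
        rw [hEe, mul_one]
        field_simp
    _ ≤ hm (w i).2 * hm (w j).2 :=
        mul_le_mul h1 h2 (by positivity) hc.le

/-- **The velocity-hole weight (headline).**  Same setting, local density eliminated (`ρm ≤ 3/πr³`):
`e^{−F} ≥ (1 − ε/r) (N+1)^{−2} exp((d₁² + d₂²)/2ϑ²)`.  Consequently one ordered contact pair contributes at least
`σ (N+1)^{−10/3} (1 − ε/r) |χ g Ψ| exp((d₁²+d₂²)/2ϑ²)` to `K_N[χ g Ψ (1 + e^{−F})]`: unbounded over configurations at every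
fixed `(N, r, ϑ)`, and larger than any `η` once `d₁² + d₂² > (20/3) ϑ² ln(N+1) + O(1)`. [folklore] -/
theorem exp_neg_surprisal_ge (w : Config (N + 1) (Fin 3) T3) {r ϑ ε d₁ d₂ : ℝ}
    (hr : 0 < r) (hϑ : 0 < ϑ) (hεr : ε ≤ r) (hd₁ : 0 ≤ d₁) (hd₂ : 0 ≤ d₂)
    {i j : Fin (N + 1)} (hdist : Torus.euclidDist (w j).1 (w i).1 ≤ ε) (vm wm : V3)
    (hvm : ∀ k, d₁ ≤ ‖vm - (w k).2‖) (hwm : ∀ k, d₂ ≤ ‖wm - (w k).2‖) :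
    let hm : V3 → ℝ := fun u => ∫ q, 3 / (Real.pi * r ^ 3) * max (1 - Torus.euclidDist q.1 (w i).1 / r) 0 *
      localMaxwellian 1 (ϑ ^ 2) u q.2 ∂(empiricalMeasure w)
    (1 - ε / r) / ((N : ℝ) + 1) ^ 2 * Real.exp ((d₁ ^ 2 + d₂ ^ 2) / (2 * ϑ ^ 2)) ≤
      Real.exp (-(Real.log (hm vm) + Real.log (hm wm) - Real.log (hm (w i).2) - Real.log (hm (w j).2))) := by
  intro hm
  have key := exp_neg_surprisal_ge_rhoMoll w hr hϑ hεr hd₁ hd₂ hdist vm wm hvm hwm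
  refine le_trans ?_ key
  -- `(1 − ε/r)/(N+1)² ≤ (3/πr³)² (1 − ε/r) / ((N+1)² ρm²)` because `0 < ρm ≤ 3/πr³`
  have hρ := rhoMoll_nonneg_le w hr (w i).1
  have hρpos : 0 < ∫ q, 3 / (Real.pi * r ^ 3) * max (1 - Torus.euclidDist q.1 (w i).1 / r) 0 ∂(empiricalMeasure w) :=
    lt_of_lt_of_le (by positivity) (rhoMoll_self_ge w hr i)
  have hεr' : 0 ≤ 1 - ε / r := by
    rw [sub_nonneg, div_le_one hr]
    exact hεr
  refine mul_le_mul_of_nonneg_right ?_ (Real.exp_nonneg _)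
  rw [div_le_div_iff₀ (by positivity) (by positivity)]
  have hsq : (∫ q, 3 / (Real.pi * r ^ 3) * max (1 - Torus.euclidDist q.1 (w i).1 / r) 0 ∂(empiricalMeasure w)) ^ 2 ≤
      (3 / (Real.pi * r ^ 3)) ^ 2 := pow_le_pow_left₀ hρ.1 hρ.2 2
  calc (1 - ε / r) * (((N : ℝ) + 1) ^ 2 *
        (∫ q, 3 / (Real.pi * r ^ 3) * max (1 - Torus.euclidDist q.1 (w i).1 / r) 0 ∂(empiricalMeasure w)) ^ 2)
      ≤ (1 - ε / r) * (((N : ℝ) + 1) ^ 2 * (3 / (Real.pi * r ^ 3)) ^ 2) := by gcongr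
    _ = (3 / (Real.pi * r ^ 3)) ^ 2 * (1 - ε / r) * ((N : ℝ) + 1) ^ 2 := by ring

/-- At a contact of the torus hard-sphere geometry, `‖sepVec xᵢ xⱼ‖ = ε` is the minimal-image distance, in either order
(the hypothesis `hdist` of the two bounds above). [folklore] -/
theorem euclidDist_le_of_norm_sepVec_eq {x y : T3} {ε : ℝ}
    (h : ‖(Torus.geometry (Fin 3)).sepVec x y‖ = ε) : Torus.euclidDist y x ≤ ε := by
  rw [Torus.norm_geometry_sepVec, Torus.euclidDist_comm] at h
  exact h.le

/-! ## Why the repair C′ (energy-shell support of the marks) removes the mechanism -/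

/-- **Shell support confines all four queries.**  If a mark vanishes outside the energy shell `‖v‖² + ‖w‖² < R` and does
not vanish at the pre-collisional pair `(v⁻, w⁻) = reflectVel n (vᵢ, vⱼ)`, then all four velocities at which the crux
queries the mollified law — `v⁻, w⁻` (denominator of `e^{−F}`) and the current `vᵢ, vⱼ` (numerator) — lie in the closed ball
of radius `√R` (energy conservation of the elastic reflection), where a kernel density estimate of a law with Gaussian
tails is reliable; this is the planner's repair C′ of BlowupAnalysis.md §6. [folklore] -/
theorem shell_support_confines_queries {Ψ : V3 × V3 × V3 → ℝ} {R : ℝ}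
    (hΨ : ∀ q, R ≤ ‖q.2.1‖ ^ 2 + ‖q.2.2‖ ^ 2 → Ψ q = 0) (n vi vj : V3) {m : V3}
    (hne : Ψ (m, (reflectVel n (vi, vj)).1, (reflectVel n (vi, vj)).2) ≠ 0) :
    ‖(reflectVel n (vi, vj)).1‖ ^ 2 ≤ R ∧ ‖(reflectVel n (vi, vj)).2‖ ^ 2 ≤ R ∧ ‖vi‖ ^ 2 ≤ R ∧ ‖vj‖ ^ 2 ≤ R := by
  have hlt : ‖(reflectVel n (vi, vj)).1‖ ^ 2 + ‖(reflectVel n (vi, vj)).2‖ ^ 2 < R := by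
    by_contra hge
    exact hne (hΨ _ (not_lt.1 hge))
  have hcons := norm_sq_reflectVel_fst_add_norm_sq_reflectVel_snd n (vi, vj)
  have h1 := sq_nonneg ‖(reflectVel n (vi, vj)).1‖
  have h2 := sq_nonneg ‖(reflectVel n (vi, vj)).2‖
  have h3 := sq_nonneg ‖vi‖
  have h4 := sq_nonneg ‖vj‖
  simp only at hcons
  refine ⟨by linarith, by linarith, by linarith, by linarith⟩

end OddContactSymmetryNegative

end Summit.AtomisticToContinuum.HydrodynamicLimit.Theorems
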